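import Mathlib
import Summits.ValiantsHypothesis.ValiantsHypothesis.Theorems.FifoMatchingNNNotVPSupportFnMatchings
import Summits.ValiantsHypothesis.ValiantsHypothesis.Theorems.FifoMatchingNNNotVPSupportFnCore
import Literature.Computability.AlgebraicComplexity.NestFreeMatchingPoly
import HarnessLib

/-!
# Route FifoMatching — crux `NNDivisionHard` (stmt-ValiantsHypothesis-21181):
# UNDOMINATED cofactors are exactly those that AVOID a nest-free perfect matching

The residual enemy class of record for 21181 (`GrandResidual.nnDivisionHard_iff_grandResidual`, ✓ p823791)
carries the conjunct UNDOMINATED (negation of the hypothesis of the Boolean-shadow domination rung, ✓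
p823553): for every arc set `T` of `≤ (log₂ n + k)^k` arcs,

  `∃ A, SuppFn (NN_n|_{T:=1}) A ∧ ¬ SuppFn (h|_{T:=1}) A`.

This route-independent file (no `Theses` import) rewrites that conjunct as a concrete combinatorial
property of the cofactor, with a nest-free perfect matching as the witness (`arcs M` is written inline
as `{(i, M i) : i < M i}`):

* `undominated_iff_exists_avoided_nfpm` — for every `T`:
  `(∃ A, SuppFn (NN_n|_{T:=1}) A ∧ ¬ SuppFn (h|_{T:=1}) A) ↔ ∃ M ∈ nestFreeMatchings (2n), ¬ SuppFn (h|_{T:=1}) (arcs M)`,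
  i.e. some nest-free perfect matching `M` is AVOIDED by `h` modulo `T`: no monomial of `h|_{T:=1}` is
  supported inside the arc set of `M` — equivalently (landed `suppFn_iff_eval_ne_zero`) `h|_{T:=1}`
  VANISHES at the 0/1 point `1_{arcs M}`.
* `undominatedAt_empty_iff` — without free arcs: `h` is undominated iff some nest-free perfect matching
  carries no monomial of `h`, i.e. `h(1_{arcs M}) = 0`.

So a surviving enemy cofactor of 21181 is a cheap, torus-homogeneous, window-dense, deep, spread polynomial
`h ≥ 0` such that for EVERY polylogarithmic set `T` of freed arcs `h|_{T:=1}` vanishes at the arc-indicator of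
some nest-free perfect matching `M_T`.  Honest framing: a reformulation (no new decided class); 21181,
`NNNotVP` and `VP ≠ VNP` stay OPEN.  No definitions, no named facts.
-/

noncomputable section

-- Sub = Summit single-conjunct layout: the duplicated namespace component is mandated by the tree.
set_option linter.dupNamespace false
set_option autoImplicit false

namespace Summit.ValiantsHypothesis.ValiantsHypothesis.Theorems.FifoMatching.NNDivisionHard.AvoidedMatching

open MvPolynomial Finset Literature.Computability.AlgebraicComplexity
open scoped NNReal BigOperators Classical
open Summit.ValiantsHypothesis.ValiantsHypothesis.Theorems.FifoMatching.NNNotVP.DivisionSplit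
  (σ NN SuppFn freeVars suppFn_iff_eval_ne_zero suppFn_freeVars_iff suppFn_NN_iff)

variable {n : ℕ}

/-- The arc set of a nest-free perfect matching carries `NN_n`, with any arcs freed:
`SuppFn (NN_n|_{T:=1}) (arcs M)`. [folklore] -/
theorem suppFn_freeVars_NN_arcs (T : Finset (σ n)) {M : Fin (2 * n) → Fin (2 * n)}
    (hM : M ∈ nestFreeMatchings (2 * n)) :
    SuppFn (freeVars T (NN n)) (univ.filter fun e : σ n => e.1 < M e.1 ∧ M e.1 = e.2) := by
  rw [suppFn_freeVars_iff, suppFn_NN_iff]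
  refine ⟨M, hM, fun i hi => ?_⟩
  simp only [Finset.mem_union, Finset.mem_filter, Finset.mem_univ, true_and]
  exact Or.inr ⟨hi, trivial⟩

/-- The arc set of a nest-free perfect matching carries `NN_n`. [folklore] -/
theorem suppFn_NN_arcs {M : Fin (2 * n) → Fin (2 * n)} (hM : M ∈ nestFreeMatchings (2 * n)) :
    SuppFn (NN n) (univ.filter fun e : σ n => e.1 < M e.1 ∧ M e.1 = e.2) := by
  rw [suppFn_NN_iff]
  refine ⟨M, hM, fun i hi => ?_⟩
  simp only [Finset.mem_filter, Finset.mem_univ, true_and]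
  exact ⟨hi, trivial⟩

/-- ★ **Undominated (modulo `T`) ⟺ some nest-free perfect matching is avoided (modulo `T`).**
[folklore] -/
theorem undominated_iff_exists_avoided_nfpm (T : Finset (σ n)) (h : MvPolynomial (σ n) ℝ≥0) :
    (∃ A : Finset (σ n), SuppFn (freeVars T (NN n)) A ∧ ¬ SuppFn (freeVars T h) A) ↔
      ∃ M ∈ nestFreeMatchings (2 * n),
        ¬ SuppFn (freeVars T h) (univ.filter fun e : σ n => e.1 < M e.1 ∧ M e.1 = e.2) := by
  constructor
  · rintro ⟨A, hA, hnot⟩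
    rw [suppFn_freeVars_iff] at hA
    obtain ⟨M, hM, hMA⟩ := (suppFn_NN_iff n _).1 hA
    refine ⟨M, hM, fun hsupp => hnot ?_⟩
    rw [suppFn_freeVars_iff] at hsupp ⊢
    -- `T ∪ arcs M ⊆ T ∪ A`
    refine hsupp.mono fun x hx => ?_
    simp only [Finset.mem_union, Finset.mem_filter, Finset.mem_univ, true_and] at hx
    rcases hx with hxT | ⟨h1, h2⟩
    · simp only [Finset.mem_union]
      exact Or.inl hxT
    · have hmem := hMA x.1 h1
      rw [h2] at hmem
      exact hmem
  · rintro ⟨M, hM, hnot⟩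
    exact ⟨_, suppFn_freeVars_NN_arcs T hM, hnot⟩

/-- **Without free arcs**: `h` is undominated (`∃ A, SuppFn NN_n A ∧ ¬ SuppFn h A`) iff some nest-free
perfect matching `M` carries no monomial of `h` (equivalently, by `suppFn_iff_eval_ne_zero`,
`h(1_{arcs M}) = 0`). [folklore] -/
theorem undominatedAt_empty_iff (h : MvPolynomial (σ n) ℝ≥0) :
    (∃ A : Finset (σ n), SuppFn (NN n) A ∧ ¬ SuppFn h A) ↔
      ∃ M ∈ nestFreeMatchings (2 * n),
        ¬ SuppFn h (univ.filter fun e : σ n => e.1 < M e.1 ∧ M e.1 = e.2) := by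
  constructor
  · rintro ⟨A, hA, hnot⟩
    obtain ⟨M, hM, hMA⟩ := (suppFn_NN_iff n A).1 hA
    refine ⟨M, hM, fun hsupp => hnot (hsupp.mono fun x hx => ?_)⟩
    simp only [Finset.mem_filter, Finset.mem_univ, true_and] at hx
    obtain ⟨h1, h2⟩ := hx
    have hmem := hMA x.1 h1
    rw [h2] at hmem
    exact hmem
  · rintro ⟨M, hM, hnot⟩
    exact ⟨_, suppFn_NN_arcs hM, hnot⟩

end Summit.ValiantsHypothesis.ValiantsHypothesis.Theorems.FifoMatching.NNDivisionHard.AvoidedMatching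

end
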